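import Literature.MathematicalPhysics.QuantumLattice.CPeriodicFermionPfaffian
import Literature.MathematicalPhysics.QuantumLattice.GrassmannIntegralWilsonProofs
import Literature.MathematicalPhysics.QuantumFieldTheory.GammaHermiticityPfaffian
import Literature.MathematicalPhysics.QuantumLattice.WilsonQuarkMatrixPositivity
import HarnessLib

/-!
# The C⋆-periodic fermion Pfaffian `Pf_K(C D_𝒥)` is real; anatomy of its sign

Sequel of `CPeriodicFermionPfaffian.lean` (the C⋆-periodic fermionic integral of one Wilson
flavour IS `Pf_K(C D_𝒥)`, `C D_𝒥` antisymmetric, `(Pf_K C D_𝒥)² = Det_K D_𝒥`), which left the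
second half of Lucini–Patella–Ramos–Tantalo 2016, App. D "Anatomy of the sign problem" — the
reality and the sign of the Pfaffian by `γ₅`-hermiticity — as a citation.  Here it becomes a
theorem about the tree's objects `cstarWilsonDirac S ρ U m r` (`D_𝒥`, doublet variables, `K`
boundary conditions in the C-directions `S`), `spinChargeConj` (`C ⊗ 1`) and `cstarFermionPfaffian`
(the Berezin integral), for every unitary colour representation `ρ`, every gauge field `U`, every
real `m`, `r`, any `L ≥ 1`, `N`:

* `cstarGammaFive`, `cstarGammaFive_mul_cstarWilsonDirac_mul_cstarGammaFive`,
  `conjTranspose_cstarWilsonDirac` — **`γ₅`-hermiticity of `D_𝒥`**, `Γ₅ D_𝒥 Γ₅ = D_𝒥ᴴ` with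
  `Γ₅ = 1 ⊗ 1 ⊗ γ₅` (the real form `𝒥(ρ(U))` and the flip `K` are real symmetric-orthogonal data,
  so Montvay–Münster's (5.15) goes through hop by hop);
* `even_rootMultiplicity_charpoly_cstarWilsonDirac` — "the algebraic multiplicity of `λ_α` is
  `2m_α`": every eigenvalue of `D_𝒥` has EVEN algebraic multiplicity
  (`Literature.LinearAlgebra.Matrix.even_rootMultiplicity_charpoly`: `χ_{D_𝒥} = [Pf(C(D_𝒥 − X))]²`);
* `det_cstarWilsonDirac_sub_scalar_nonneg`, `det_cstarWilsonDirac_nonneg` — "the determinant is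
  positive if `s` is real": `Det_K(D_𝒥 − s) ≥ 0`, `Det_K D_𝒥 ≥ 0`;
* **`cstarFermionPfaffian_im_eq_zero`** — "consequently the Pfaffian is real":
  `Im Pf_K(C D_𝒥) = 0`;
* `cstarFermionPfaffian_eq_prod_eigenvalues` — the printed formula
  `Pf_K C D_𝒥 = ∏_{Im λ_α = 0} λ_α^{m_α} ∏_{Im λ_α > 0} |λ_α^{m_α}|²` (roots of the Pfaffian
  characteristic polynomial with multiplicity), with the `s → ∞` normalisation — the reference
  Pfaffian `Pf(C ⊗ 1) = ±1` in the tree's enumeration of the doublet variables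
  (`pfaffian_spinChargeConj_eq_one_or`) — kept explicit;
* **`cstarFermionPfaffian_sign_of_no_negative_eigenvalue`** — "clearly the Pfaffian is negative
  only if the Dirac operator `D_𝒥` has some negative eigenvalues": if no real eigenvalue of `D_𝒥`
  is negative, `Pf_K(C D_𝒥) = Pf(C ⊗ 1) · r` with `r ≥ 0`; strict form for positive real
  eigenvalues.

* (v2, section `UnitaryLinks`) `realify_mul`, `cstarUnitaryLinks`,
  **`cstarWilsonDirac_eq_reindex_wilsonDirac`** — "`𝒥(V)` defines a representation of the gauge
  group, unitarily equivalent to the representation defined by `V`": with the flips `K` absorbed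
  into the links, `D_𝒥` IS the tree's `wilsonDirac` for the unitary link field `𝒥(ρU)K ∈ U(2N)`;
  hence (transfer of `WilsonQuarkMatrixPositivity.lean`) `re_star_dotProduct_cstarWilsonDirac_mulVec_ge`
  (`Re⟨v, D_𝒥 v⟩ ≥ m⟨v, v⟩` at `r = 1`), `re_eigenvalue_cstarWilsonDirac_ge` (every eigenvalue has
  real part `≥ m`), and **`cstarFermionPfaffian_sign_of_mass_pos`**: for `r = 1`, `m > 0`
  (`κ < 1/8`) the C⋆ Pfaffian has the CONSTANT reference sign `Pf(C ⊗ 1)` for every gauge field —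
  the lattice, heavy-quark face of the paper's continuum remark "the real part of the eigenvalues
  of the Dirac operator is always positive (and equal to `m`) therefore the Pfaffian is positive";
  `det_cstarWilsonDirac_pos_of_mass_pos`.

Not here: the continuum limit itself; light quarks (`κ ≥ 1/8`), where the sign is carried as
printed ("a mild sign problem … completely analogous to the single-flavour case").

## References

* B. Lucini, A. Patella, A. Ramos, N. Tantalo, *Charged hadrons in local finite-volume QED+QCD with
  C⋆ boundary conditions*, JHEP **02** (2016) 076, arXiv:1509.01636, App. D "Anatomy of the sign
  problem" [corpus:paper-arxiv-1509.01636 p0031 L85–L112]. [LuciniEtAl2016]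
* I. Montvay, G. Münster, *Quantum Fields on a Lattice* (1994), §5.1.2 (5.15) (`γ₅`-hermiticity).
  [MontvayMunster1994]
* I. Montvay, Int. J. Mod. Phys. A **17** (2002) 2377, hep-lat/0112007, eqs. (44)–(47). [Montvay2002]
-/

noncomputable section

namespace Literature.MathematicalPhysics.QuantumLattice

open scoped Matrix Kronecker ComplexConjugate
open _root_.Matrix QuantumFieldTheory Literature.LinearAlgebra.Matrix
open Literature.MathematicalPhysics.QuantumFieldTheory.GammaHermiticity

variable {L N : ℕ} {G : Type*} [Group G] (S : Finset (Fin 4)) (ρ : G →* Matrix (Fin N) (Fin N) ℂ)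

/-! ## `γ₅` on the doublet quark variables -/

/-- `Γ₅ = 1 ⊗ 1 ⊗ γ₅`: the chirality matrix acting on the spin index of the doublet quark variables
`η = (ψ₊, −iψ₋)` (index `site × (doublet × colour) × spin`), the `γ₅` of "the `γ₅`-hermiticity of
the Dirac operator" `D_𝒥` invoked in the sign analysis. [cite: LuciniEtAl2016, App. D (γ₅-hermiticity of the Dirac operator)] -/
def cstarGammaFive :
    Matrix (Site 4 L × (Fin 2 × Fin N) × Fin 4) (Site 4 L × (Fin 2 × Fin N) × Fin 4) ℂ :=
  (1 : Matrix (Site 4 L) (Site 4 L) ℂ) ⊗ₖ ((1 : Matrix (Fin 2 × Fin N) (Fin 2 × Fin N) ℂ) ⊗ₖ gammaFive)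

/-- `Γ₅` is the diagonal sign matrix `p ↦ ε_{spin p}`, `ε = (1, 1, −1, −1)` (chiral basis).
[cite: MontvayMunster1994, App. 8.1.2 (8.10)] -/
theorem cstarGammaFive_eq_diagonal :
    (cstarGammaFive : Matrix (Site 4 L × (Fin 2 × Fin N) × Fin 4) _ ℂ) =
      diagonal fun p => (![1, 1, -1, -1] : Fin 4 → ℂ) p.2.2 := by
  simp only [cstarGammaFive, gammaFive_eq_diagonal, ← diagonal_one, diagonal_kronecker_diagonal,
    one_mul]

/-- `Γ₅² = 1`. [cite: MontvayMunster1994, App. 8.1.2 (8.10)] -/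
theorem cstarGammaFive_mul_self [NeZero L] :
    (cstarGammaFive : Matrix (Site 4 L × (Fin 2 × Fin N) × Fin 4) _ ℂ) * cstarGammaFive = 1 := by
  rw [cstarGammaFive_eq_diagonal, diagonal_mul_diagonal, ← diagonal_one]
  congr 1
  funext p
  exact gammaFiveSign_mul_self p.2.2

/-! ## Reality of the colour–doublet hop matrices -/

/-- The real form `𝒥(V) = 1 ⊗ Re V + J ⊗ Im V` has real entries. [folklore] -/
private theorem star_realify_apply {n : Type*} (V : Matrix n n ℂ) (i j : Fin 2 × n) :
    star (realify V i j) = realify V i j := by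
  obtain ⟨a, c⟩ := i
  obtain ⟨b, d⟩ := j
  fin_cases a <;> fin_cases b <;> simp [realify, realJ, Matrix.kroneckerMap_apply]

/-- `Kᵀ = K`. [folklore] -/
private theorem kFlip_transpose' : kFlipᵀ = kFlip := by
  ext i j; fin_cases i <;> fin_cases j <;> simp [kFlip]

/-- `Kᴴ = K` (real entries). [folklore] -/
private theorem kFlip_conjTranspose : kFlipᴴ = kFlip := by
  ext i j; fin_cases i <;> fin_cases j <;> simp [kFlip, Matrix.conjTranspose_apply]

/-- `(kAt x μ)ᵀ = kAt x μ`. [folklore] -/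
private theorem kAt_transpose' (x : Site 4 L) (μ : Fin 4) :
    (kAt (N := N) S x μ)ᵀ = kAt (N := N) S x μ := by
  unfold kAt
  split_ifs
  · rw [← Matrix.kroneckerMap_transpose, kFlip_transpose', Matrix.transpose_one]
  · rw [Matrix.transpose_one]

/-- `(kAt x μ)ᴴ = kAt x μ`. [folklore] -/
private theorem kAt_conjTranspose (x : Site 4 L) (μ : Fin 4) :
    (kAt (N := N) S x μ)ᴴ = kAt (N := N) S x μ := by
  unfold kAt
  split_ifs
  · rw [Matrix.conjTranspose_kronecker, kFlip_conjTranspose, Matrix.conjTranspose_one]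
  · rw [Matrix.conjTranspose_one]

/-- The boundary flip `kAt` (`K ⊗ 1` or `1`) has real entries. [folklore] -/
private theorem star_kAt_apply (x : Site 4 L) (μ : Fin 4) (i j : Fin 2 × Fin N) :
    star (kAt (N := N) S x μ i j) = kAt (N := N) S x μ i j := by
  rw [← Matrix.conjTranspose_apply, kAt_conjTranspose, ← Matrix.transpose_apply (kAt (N := N) S x μ) j i,
    kAt_transpose']

/-- For a unitary matrix representation, `ρ(g⁻¹) = ρ(g)†`. [folklore] -/
private theorem map_inv_eq_conjTranspose' (hρ : ∀ g, (ρ g)ᴴ * ρ g = 1) (g : G) :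
    ρ g⁻¹ = (ρ g)ᴴ := by
  have h1 : ρ g⁻¹ * ρ g = 1 := by rw [← map_mul, inv_mul_cancel, map_one]
  rw [← Matrix.inv_eq_left_inv h1, Matrix.inv_eq_left_inv (hρ g)]

/-- The backward hop matrix is the transpose of the forward one:
`K 𝒥(U⁻¹) = K 𝒥(U)ᵀ = (𝒥(U) K)ᵀ` for unitary `ρ`. [folklore] -/
private theorem kAt_mul_realify_inv (hρ : ∀ g, (ρ g)ᴴ * ρ g = 1) (U : GaugeConfig 4 L G)
    (x : Site 4 L) (μ : Fin 4) :
    kAt (N := N) S x μ * realify (ρ (U (x, μ))⁻¹) = (realify (ρ (U (x, μ))) * kAt (N := N) S x μ)ᵀ := by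
  rw [map_inv_eq_conjTranspose' ρ hρ, realify_conjTranspose, Matrix.transpose_mul, kAt_transpose']

/-- Entrywise: `conj ((K 𝒥(U⁻¹))_{ab}) = (𝒥(U) K)_{ba}` (the hop matrices are real).
[folklore] -/
private theorem star_kAt_mul_realify_inv_apply (hρ : ∀ g, (ρ g)ᴴ * ρ g = 1)
    (U : GaugeConfig 4 L G) (x : Site 4 L) (μ : Fin 4) (a b : Fin 2 × Fin N) :
    star ((kAt (N := N) S x μ * realify (ρ (U (x, μ))⁻¹)) a b) =
      (realify (ρ (U (x, μ))) * kAt (N := N) S x μ) b a := by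
  rw [kAt_mul_realify_inv S ρ hρ, Matrix.transpose_apply, Matrix.mul_apply, star_sum]
  refine Finset.sum_congr rfl fun k _ => ?_
  rw [star_mul', star_realify_apply, star_kAt_apply]

/-- Entrywise, the other way round: `conj ((𝒥(U) K)_{ab}) = (K 𝒥(U⁻¹))_{ba}`. [folklore] -/
private theorem star_realify_mul_kAt_apply (hρ : ∀ g, (ρ g)ᴴ * ρ g = 1)
    (U : GaugeConfig 4 L G) (x : Site 4 L) (μ : Fin 4) (a b : Fin 2 × Fin N) :
    star ((realify (ρ (U (x, μ))) * kAt (N := N) S x μ) a b) =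
      (kAt (N := N) S x μ * realify (ρ (U (x, μ))⁻¹)) b a := by
  rw [← star_kAt_mul_realify_inv_apply S ρ hρ, star_star]

/-! ## `γ₅`-hermiticity of `D_𝒥` -/

variable [NeZero L] (U : GaugeConfig 4 L G) (m r : ℝ)

/-- **`γ₅`-hermiticity of the C⋆-periodic Wilson–Dirac operator**: `Γ₅ D_𝒥 Γ₅ = D_𝒥ᴴ` for every
unitary colour representation `ρ` — the doublet operator is a Wilson–Dirac operator whose colour
matrices `𝒥(ρ(U)) K` are real orthogonal, so Montvay–Münster's (5.15) "`Q_{yx} = γ₅ Q†_{xy} γ₅`"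
holds hop by hop ("the `γ₅`-hermiticity of the Dirac operator", Lucini et al. App. D).
[cite: LuciniEtAl2016, App. D (γ₅-hermiticity of the Dirac operator)] -/
theorem cstarGammaFive_mul_cstarWilsonDirac_mul_cstarGammaFive (hρ : ∀ g, (ρ g)ᴴ * ρ g = 1) :
    cstarGammaFive * cstarWilsonDirac S ρ U m r * cstarGammaFive = (cstarWilsonDirac S ρ U m r)ᴴ := by
  rw [cstarGammaFive_eq_diagonal]
  ext p q
  rw [mul_diagonal, diagonal_mul, conjTranspose_apply]
  simp only [cstarWilsonDirac, of_apply]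
  refine sign_conj_entry_aux _ _ _ _ _ _ _ _ _ ?_ (by simp) (fun μ => ?_) (fun μ => ?_)
  · -- mass term
    by_cases h : p = q
    · subst h
      rw [if_pos rfl, mul_right_comm, gammaFiveSign_mul_self, one_mul]
      exact (Complex.conj_ofReal _).symm
    · rw [if_neg h, if_neg (Ne.symm h), mul_zero, zero_mul, star_zero]
  · -- forward hop of `D_{pq}` versus backward hop of `D_{qp}`
    split_ifs with h
    · rw [star_mul', ← gammaFiveSign_mul_sub_euclideanGamma_mul_gammaFiveSign r μ p.2.2 q.2.2,
        star_kAt_mul_realify_inv_apply S ρ hρ]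
      ring
    · rw [mul_zero, zero_mul, star_zero]
  · -- backward hop of `D_{pq}` versus forward hop of `D_{qp}`
    split_ifs with h
    · rw [star_mul', ← gammaFiveSign_mul_add_euclideanGamma_mul_gammaFiveSign r μ p.2.2 q.2.2,
        star_realify_mul_kAt_apply S ρ hρ]
      ring
    · rw [mul_zero, zero_mul, star_zero]

/-- `γ₅`-hermiticity in the conjugation form `D_𝒥ᴴ = Γ₅ D_𝒥 Γ₅⁻¹` consumed by
`GammaHermiticity.lean` (`Γ₅⁻¹ = Γ₅`). [cite: LuciniEtAl2016, App. D (γ₅-hermiticity of the Dirac operator)] -/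
theorem conjTranspose_cstarWilsonDirac (hρ : ∀ g, (ρ g)ᴴ * ρ g = 1) :
    (cstarWilsonDirac S ρ U m r)ᴴ = cstarGammaFive * cstarWilsonDirac S ρ U m r * cstarGammaFive⁻¹ := by
  rw [Matrix.inv_eq_left_inv (cstarGammaFive_mul_self (L := L) (N := N)),
    cstarGammaFive_mul_cstarWilsonDirac_mul_cstarGammaFive S ρ U m r hρ]

/-! ## The data of the abstract sign analysis, in the tree's enumeration of the doublet variables -/

/-- Over `ℂ` an antisymmetric matrix has zero diagonal. [folklore] -/
private theorem apply_self_eq_zero_of_transpose_eq_neg {ι : Type*} (M : Matrix ι ι ℂ)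
    (hM : Mᵀ = -M) (i : ι) : M i i = 0 := by
  have h := congrFun (congrFun hM i) i
  rw [transpose_apply, neg_apply] at h
  have h2 : (2 : ℂ) * M i i = 0 := by linear_combination h
  simpa using h2

/-- `det γ_μ = 1`. [folklore] -/
private theorem det_euclideanGamma' (μ : Fin 4) : (euclideanGamma μ).det = 1 := by
  fin_cases μ <;>
    simp [euclideanGamma, QuantumLattice.spinHalfPauli, Matrix.det_kronecker, Matrix.det_fin_two]

/-- `det (1 ⊗ 1 ⊗ C) = 1` (`det C = det γ₁ det γ₃ = 1`). [folklore] -/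
private theorem det_spinChargeConj' :
    (spinChargeConj : Matrix (Site 4 L × (Fin 2 × Fin N) × Fin 4) _ ℂ).det = 1 := by
  rw [spinChargeConj, Matrix.det_kronecker, Matrix.det_kronecker, Matrix.det_one, Matrix.det_one,
    chargeConj, Matrix.det_mul, det_euclideanGamma', det_euclideanGamma']
  simp

/-- Re-indexing along an equivalence is multiplicative. [folklore] -/
private theorem reindex_mul_reindex {ι : Type*} [Fintype ι] (e : ι ≃ CstarIdx L N)
    (M P : Matrix ι ι ℂ) : reindex e e M * reindex e e P = reindex e e (M * P) := by
  simp only [reindex_apply]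
  exact submatrix_mul_equiv M P e.symm e.symm e.symm

/-- The re-indexed `C ⊗ 1` is alternating. [cite: LuciniEtAl2016, §2 (the charge conjugation matrix)] -/
theorem transpose_reindex_spinChargeConj :
    (reindex cstarIdxEquiv cstarIdxEquiv
        (spinChargeConj : Matrix (Site 4 L × (Fin 2 × Fin N) × Fin 4) _ ℂ))ᵀ =
      -reindex cstarIdxEquiv cstarIdxEquiv spinChargeConj := by
  rw [transpose_reindex, spinChargeConj_transpose]
  ext i j
  simp [reindex_apply]

/-- The re-indexed `C ⊗ 1` has determinant `1` — "`Det_K C D_𝒥 = Det_K D_𝒥`".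
[cite: LuciniEtAl2016, App. D ((Pf_K CD_𝒥)² = Det_K D_𝒥)] -/
theorem det_reindex_spinChargeConj :
    (reindex cstarIdxEquiv cstarIdxEquiv
        (spinChargeConj : Matrix (Site 4 L × (Fin 2 × Fin N) × Fin 4) _ ℂ)).det = 1 := by
  rw [det_reindex_self, det_spinChargeConj']

/-- The product of the re-indexed `C ⊗ 1` and `D_𝒥` is the re-indexed `(C ⊗ 1) D_𝒥`, which is
alternating for unitary `ρ` (`transpose_reindex_spinChargeConj_mul_cstarWilsonDirac`).
[cite: LuciniEtAl2016, App. D (C D_𝒥 antisymmetric)] -/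
theorem transpose_reindex_spinChargeConj_mul_reindex_cstarWilsonDirac (hρ : ∀ g, (ρ g)ᴴ * ρ g = 1) :
    (reindex cstarIdxEquiv cstarIdxEquiv spinChargeConj *
        reindex cstarIdxEquiv cstarIdxEquiv (cstarWilsonDirac S ρ U m r))ᵀ =
      -(reindex cstarIdxEquiv cstarIdxEquiv spinChargeConj *
        reindex cstarIdxEquiv cstarIdxEquiv (cstarWilsonDirac S ρ U m r)) := by
  rw [reindex_mul_reindex, transpose_reindex_spinChargeConj_mul_cstarWilsonDirac S ρ hρ U m r]

/-- The re-indexed `Γ₅` squares to one. [cite: MontvayMunster1994, App. 8.1.2 (8.10)] -/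
theorem reindex_cstarGammaFive_mul_self :
    reindex cstarIdxEquiv cstarIdxEquiv
        (cstarGammaFive : Matrix (Site 4 L × (Fin 2 × Fin N) × Fin 4) _ ℂ) *
      reindex cstarIdxEquiv cstarIdxEquiv cstarGammaFive = 1 := by
  rw [reindex_mul_reindex, cstarGammaFive_mul_self, reindex_apply, submatrix_one_equiv]

/-- `det` of the re-indexed `Γ₅` is a unit. [cite: MontvayMunster1994, App. 8.1.2 (8.10)] -/
theorem isUnit_det_reindex_cstarGammaFive :
    IsUnit (reindex cstarIdxEquiv cstarIdxEquiv
      (cstarGammaFive : Matrix (Site 4 L × (Fin 2 × Fin N) × Fin 4) _ ℂ)).det := by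
  refine IsUnit.of_mul_eq_one (reindex cstarIdxEquiv cstarIdxEquiv
    (cstarGammaFive : Matrix (Site 4 L × (Fin 2 × Fin N) × Fin 4) _ ℂ)).det ?_
  rw [← det_mul, reindex_cstarGammaFive_mul_self, det_one]

/-- `γ₅`-hermiticity of the re-indexed `D_𝒥`, in conjugation form.
[cite: LuciniEtAl2016, App. D (γ₅-hermiticity of the Dirac operator)] -/
theorem conjTranspose_reindex_cstarWilsonDirac (hρ : ∀ g, (ρ g)ᴴ * ρ g = 1) :
    (reindex cstarIdxEquiv cstarIdxEquiv (cstarWilsonDirac S ρ U m r))ᴴ =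
      reindex cstarIdxEquiv cstarIdxEquiv cstarGammaFive *
        reindex cstarIdxEquiv cstarIdxEquiv (cstarWilsonDirac S ρ U m r) *
        (reindex cstarIdxEquiv cstarIdxEquiv cstarGammaFive)⁻¹ := by
  rw [Matrix.inv_eq_left_inv (reindex_cstarGammaFive_mul_self (L := L) (N := N)),
    reindex_mul_reindex, reindex_mul_reindex, conjTranspose_reindex,
    cstarGammaFive_mul_cstarWilsonDirac_mul_cstarGammaFive S ρ U m r hρ]

/-! ## Even multiplicities, non-negative determinant, real Pfaffian -/

/-- **"The algebraic multiplicity of `λ_α` is `2m_α`"**: every eigenvalue of the C⋆-periodic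
Wilson–Dirac operator `D_𝒥` (unitary `ρ`, any `U`, real `m`, `r`) has EVEN algebraic multiplicity
— its characteristic polynomial is the square of the Pfaffian characteristic polynomial
`Pf((C ⊗ 1)(D_𝒥 − X))`. [cite: LuciniEtAl2016, App. D (algebraic multiplicity 2m_α)] -/
theorem even_rootMultiplicity_charpoly_cstarWilsonDirac (hρ : ∀ g, (ρ g)ᴴ * ρ g = 1) (μ : ℂ) :
    Even ((cstarWilsonDirac S ρ U m r).charpoly.rootMultiplicity μ) := by
  rw [← charpoly_reindex cstarIdxEquiv (cstarWilsonDirac S ρ U m r)]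
  exact even_rootMultiplicity_charpoly _ _ transpose_reindex_spinChargeConj
    (apply_self_eq_zero_of_transpose_eq_neg _ transpose_reindex_spinChargeConj)
    (transpose_reindex_spinChargeConj_mul_reindex_cstarWilsonDirac S ρ U m r hρ)
    (apply_self_eq_zero_of_transpose_eq_neg _
      (transpose_reindex_spinChargeConj_mul_reindex_cstarWilsonDirac S ρ U m r hρ))
    (by rw [det_reindex_spinChargeConj]; exact one_ne_zero) μ

/-- **"The determinant is positive if `s` is real"**: `Det_K(D_𝒥 − s) ≥ 0` for every real `s`
(unitary `ρ`). [cite: LuciniEtAl2016, App. D (determinant positive for real s)] -/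
theorem det_cstarWilsonDirac_sub_scalar_nonneg (hρ : ∀ g, (ρ g)ᴴ * ρ g = 1) (s : ℝ) :
    ∃ t : ℝ, 0 ≤ t ∧
      (cstarWilsonDirac S ρ U m r -
        Matrix.scalar (Site 4 L × (Fin 2 × Fin N) × Fin 4) (s : ℂ)).det = (t : ℂ) := by
  obtain ⟨t, ht, hdet⟩ := det_sub_scalar_nonneg_of_alternating
    (reindex cstarIdxEquiv cstarIdxEquiv spinChargeConj)
    (reindex cstarIdxEquiv cstarIdxEquiv (cstarWilsonDirac S ρ U m r))
    isUnit_det_reindex_cstarGammaFive (conjTranspose_reindex_cstarWilsonDirac S ρ U m r hρ)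
    transpose_reindex_spinChargeConj
    (transpose_reindex_spinChargeConj_mul_reindex_cstarWilsonDirac S ρ U m r hρ)
    (by rw [det_reindex_spinChargeConj]; exact one_ne_zero) s
  refine ⟨t, ht, ?_⟩
  rw [← hdet, ← det_reindex_self cstarIdxEquiv]
  congr 1
  ext i j
  simp [reindex_apply, Matrix.sub_apply, Matrix.scalar_apply, diagonal_apply,
    (cstarIdxEquiv (L := L) (N := N)).symm.injective.eq_iff]

/-- **`Det_K D_𝒥 ≥ 0`**: the one-flavour C⋆-periodic Wilson determinant is a non-negative real
number (unitary `ρ`; it is the square of the real Pfaffian). [cite: LuciniEtAl2016, App. D (determinant positive for real s)] -/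
theorem det_cstarWilsonDirac_nonneg (hρ : ∀ g, (ρ g)ᴴ * ρ g = 1) :
    ∃ t : ℝ, 0 ≤ t ∧ (cstarWilsonDirac S ρ U m r).det = (t : ℂ) := by
  simpa using det_cstarWilsonDirac_sub_scalar_nonneg S ρ U m r hρ 0

/-- **"… and consequently the Pfaffian is real"** (Lucini–Patella–Ramos–Tantalo 2016, App. D):
the C⋆-periodic fermionic integral of one Wilson flavour, `Pf_K(C D_𝒥) = ∫ 𝒟η e^{½ ηᵀ C D_𝒥 η}`
(the tree's Berezin integral `cstarFermionPfaffian`), is a REAL number, for every unitary colour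
representation `ρ`, every gauge field `U` and all real `m`, `r`.
[cite: LuciniEtAl2016, App. D (the Pfaffian itself is real)] -/
theorem cstarFermionPfaffian_im_eq_zero (hρ : ∀ g, (ρ g)ᴴ * ρ g = 1) :
    (cstarFermionPfaffian S ρ U m r).im = 0 := by
  rw [cstarFermionPfaffian_eq_pfaffian_of_unitary S ρ hρ U m r, ← reindex_mul_reindex]
  exact im_pfaffian_mul_eq_zero _ _ isUnit_det_reindex_cstarGammaFive
    (conjTranspose_reindex_cstarWilsonDirac S ρ U m r hρ) transpose_reindex_spinChargeConj
    (transpose_reindex_spinChargeConj_mul_reindex_cstarWilsonDirac S ρ U m r hρ)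
    det_reindex_spinChargeConj

/-- Real form: `Pf_K(C D_𝒥) = Re Pf_K(C D_𝒥)`. [cite: LuciniEtAl2016, App. D (the Pfaffian itself is real)] -/
theorem cstarFermionPfaffian_eq_ofReal_re (hρ : ∀ g, (ρ g)ᴴ * ρ g = 1) :
    cstarFermionPfaffian S ρ U m r = ((cstarFermionPfaffian S ρ U m r).re : ℂ) :=
  Complex.ext rfl (by rw [cstarFermionPfaffian_im_eq_zero S ρ U m r hρ, Complex.ofReal_im])

/-! ## The sign -/

/-- The reference sign: the Pfaffian of `C ⊗ 1` in the tree's enumeration of the doublet variables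
is `±1` (`(Pf)² = det = 1`) — the `s → ∞` normalisation of the printed formula.
[cite: LuciniEtAl2016, App. D (normalization from the s → ∞ limit)] -/
theorem pfaffian_spinChargeConj_eq_one_or :
    pfaffian (reindex cstarIdxEquiv cstarIdxEquiv
        (spinChargeConj : Matrix (Site 4 L × (Fin 2 × Fin N) × Fin 4) _ ℂ)) = 1 ∨
      pfaffian (reindex cstarIdxEquiv cstarIdxEquiv
        (spinChargeConj : Matrix (Site 4 L × (Fin 2 × Fin N) × Fin 4) _ ℂ)) = -1 :=
  pfaffian_eq_one_or_eq_neg_one _ transpose_reindex_spinChargeConj det_reindex_spinChargeConj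

/-- **The sign formula as printed**, for the C⋆-periodic Wilson flavour:
`Pf_K(C D_𝒥) = Pf(C ⊗ 1) · ∏_{Im λ_α = 0} λ_α^{m_α} · ∏_{Im λ_α > 0} |λ_α^{m_α}|²`, the
products over the roots (with multiplicity `m_α`) of the Pfaffian characteristic polynomial of
`(C ⊗ 1, D_𝒥)` — the eigenvalues of `D_𝒥` with half their algebraic multiplicity — and
`Pf(C ⊗ 1) = ±1` the normalisation (`pfaffian_spinChargeConj_eq_one_or`).
[cite: LuciniEtAl2016, App. D (eq. for Pf_K C D_𝒥 at s = 0)] -/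
theorem cstarFermionPfaffian_eq_prod_eigenvalues (hρ : ∀ g, (ρ g)ᴴ * ρ g = 1) :
    cstarFermionPfaffian S ρ U m r =
      pfaffian (reindex cstarIdxEquiv cstarIdxEquiv (spinChargeConj (L := L) (N := N))) *
        (((pfaffianCharpoly (reindex cstarIdxEquiv cstarIdxEquiv spinChargeConj)
            (reindex cstarIdxEquiv cstarIdxEquiv (cstarWilsonDirac S ρ U m r))).roots.filter
            (fun z => z.im = 0)).prod *
          (((pfaffianCharpoly (reindex cstarIdxEquiv cstarIdxEquiv spinChargeConj)
            (reindex cstarIdxEquiv cstarIdxEquiv (cstarWilsonDirac S ρ U m r))).roots.filter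
            (fun z => 0 < z.im)).map (fun z => (Complex.normSq z : ℂ))).prod) := by
  rw [cstarFermionPfaffian_eq_pfaffian_of_unitary S ρ hρ U m r, ← reindex_mul_reindex]
  exact pfaffian_mul_eq_prod_eigenvalues _ _ isUnit_det_reindex_cstarGammaFive
    (conjTranspose_reindex_cstarWilsonDirac S ρ U m r hρ) transpose_reindex_spinChargeConj
    (transpose_reindex_spinChargeConj_mul_reindex_cstarWilsonDirac S ρ U m r hρ)
    det_reindex_spinChargeConj

/-- **"Clearly the Pfaffian is negative only if the Dirac operator `D_𝒥` has some negative
eigenvalues"**: if no REAL eigenvalue of `D_𝒥` is negative, the C⋆-periodic fermion Pfaffian is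
`Pf(C ⊗ 1) · t` with `t ≥ 0` — non-negative relative to the reference sign.
[cite: LuciniEtAl2016, App. D (Pfaffian negative only if negative eigenvalues)] -/
theorem cstarFermionPfaffian_sign_of_no_negative_eigenvalue (hρ : ∀ g, (ρ g)ᴴ * ρ g = 1)
    (hnn : ∀ μ ∈ (cstarWilsonDirac S ρ U m r).charpoly.roots, μ.im = 0 → 0 ≤ μ.re) :
    ∃ t : ℝ, 0 ≤ t ∧ cstarFermionPfaffian S ρ U m r =
      pfaffian (reindex cstarIdxEquiv cstarIdxEquiv (spinChargeConj (L := L) (N := N))) * t := by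
  rw [cstarFermionPfaffian_eq_pfaffian_of_unitary S ρ hρ U m r, ← reindex_mul_reindex]
  refine pfaffian_mul_sign_of_no_negative_eigenvalue _ _ isUnit_det_reindex_cstarGammaFive
    (conjTranspose_reindex_cstarWilsonDirac S ρ U m r hρ) transpose_reindex_spinChargeConj
    (transpose_reindex_spinChargeConj_mul_reindex_cstarWilsonDirac S ρ U m r hρ)
    det_reindex_spinChargeConj fun μ hμ => hnn μ ?_
  rwa [charpoly_reindex] at hμ

/-- Strict form: if every REAL eigenvalue of `D_𝒥` is positive, the Pfaffian has exactly the
reference sign, `Pf_K(C D_𝒥) = Pf(C ⊗ 1) · t` with `t > 0`.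
[cite: LuciniEtAl2016, App. D (Pfaffian negative only if negative eigenvalues)] -/
theorem cstarFermionPfaffian_sign_of_positive_eigenvalues (hρ : ∀ g, (ρ g)ᴴ * ρ g = 1)
    (hpos : ∀ μ ∈ (cstarWilsonDirac S ρ U m r).charpoly.roots, μ.im = 0 → 0 < μ.re) :
    ∃ t : ℝ, 0 < t ∧ cstarFermionPfaffian S ρ U m r =
      pfaffian (reindex cstarIdxEquiv cstarIdxEquiv (spinChargeConj (L := L) (N := N))) * t := by
  rw [cstarFermionPfaffian_eq_pfaffian_of_unitary S ρ hρ U m r, ← reindex_mul_reindex]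
  refine pfaffian_mul_sign_of_positive_eigenvalues _ _ isUnit_det_reindex_cstarGammaFive
    (conjTranspose_reindex_cstarWilsonDirac S ρ U m r hρ) transpose_reindex_spinChargeConj
    (transpose_reindex_spinChargeConj_mul_reindex_cstarWilsonDirac S ρ U m r hρ)
    det_reindex_spinChargeConj fun μ hμ => hpos μ ?_
  rwa [charpoly_reindex] at hμ

/-! ## The real form absorbed into the links: `D_𝒥` is a Wilson–Dirac operator with unitary (real orthogonal) link matrices

"`𝒥(V)` defines a representation of the gauge group, unitarily equivalent to the representation
defined by `V`" (Lucini et al., App. D): with the boundary flips `K` absorbed into the links of the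
fundamental domain, `D_𝒥` IS the tree's gauge-covariant Wilson–Dirac operator `wilsonDirac` for the
unitary link field `W(x, μ) = 𝒥(ρ(U(x, μ))) K(x, μ) ∈ U(2N)` (colour index `Fin 2 × Fin N ≃ Fin (2N)`,
identity representation).  Consequently every theorem of the tree about `wilsonDirac` with a unitary
colour representation transfers to `D_𝒥`; we transfer Montvay–Münster's heavy-quark positivity
(`WilsonQuarkMatrixPositivity.lean`): for `r = 1` and `m > 0` (`κ < 1/8`) the Hermitian part of
`D_𝒥` is `≥ m`, so every eigenvalue has real part `≥ m > 0`, and by the sign anatomy above the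
C⋆ fermion Pfaffian then has the CONSTANT reference sign for every gauge field — the lattice face
of "in the continuum limit, the real part of the eigenvalues of the Dirac operator is always
positive (and equal to `m`) therefore the Pfaffian is positive". -/

section UnitaryLinks

omit [NeZero L] in
/-- The real form is multiplicative: `𝒥(A B) = 𝒥(A) 𝒥(B)` (`J² = −1`; "`𝒥(V)` defines a
representation of the gauge group"). [cite: LuciniEtAl2016, App. D (real form 𝒥(V) is a representation)] -/
theorem realify_mul {n : Type*} [Fintype n] [DecidableEq n] (A B : Matrix n n ℂ) :
    realify (A * B) = realify A * realify B := by
  ext ⟨a, i⟩ ⟨b, j⟩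
  fin_cases a <;> fin_cases b <;>
    simp [realify, realJ, Matrix.kroneckerMap_apply, Matrix.mul_apply, Fintype.sum_prod_type,
      Fin.sum_univ_two, Complex.mul_re, Complex.mul_im, Finset.sum_sub_distrib,
      Finset.sum_add_distrib, Finset.sum_neg_distrib] <;> ring

omit [NeZero L] in
/-- `𝒥(1) = 1`. [cite: LuciniEtAl2016, App. D (real form 𝒥(V) is a representation)] -/
theorem realify_one {n : Type*} [DecidableEq n] : realify (1 : Matrix n n ℂ) = 1 := by
  ext ⟨a, i⟩ ⟨b, j⟩
  fin_cases a <;> fin_cases b <;>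
    simp [realify, realJ, Matrix.kroneckerMap_apply, Matrix.one_apply] <;>
    split_ifs <;> simp

omit [NeZero L] in
/-- The real form has real entries: `𝒥(V)ᴴ = 𝒥(V)ᵀ`. [folklore] -/
private theorem realify_conjTranspose_eq_transpose {n : Type*} (V : Matrix n n ℂ) :
    (realify V)ᴴ = (realify V)ᵀ := by
  ext i j
  rw [conjTranspose_apply, transpose_apply, star_realify_apply]

omit [NeZero L] in
/-- `K(x, μ)² = 1`. [folklore] -/
private theorem kAt_mul_self (x : Site 4 L) (μ : Fin 4) :
    kAt (N := N) S x μ * kAt (N := N) S x μ = 1 := by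
  unfold kAt
  split_ifs
  · rw [← mul_kronecker_mul, Matrix.mul_one]
    have : kFlip * kFlip = 1 := by
      ext i j; fin_cases i <;> fin_cases j <;> simp [kFlip]
    rw [this, one_kronecker_one]
  · rw [Matrix.mul_one]

omit [NeZero L] in
/-- **The doublet⊗colour link matrices are unitary** (indeed real orthogonal): for unitary `ρ`,
`(𝒥(ρ(U)) K)ᴴ (𝒥(ρ(U)) K) = K 𝒥(ρ(U)ᴴ ρ(U)) K = K² = 1`.
[cite: LuciniEtAl2016, App. D (real form 𝒥(V) is a representation)] -/
theorem conjTranspose_realify_mul_kAt_mul_self (hρ : ∀ g, (ρ g)ᴴ * ρ g = 1) (U : GaugeConfig 4 L G)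
    (x : Site 4 L) (μ : Fin 4) :
    (realify (ρ (U (x, μ))) * kAt (N := N) S x μ)ᴴ * (realify (ρ (U (x, μ))) * kAt (N := N) S x μ) = 1 := by
  rw [conjTranspose_mul, kAt_conjTranspose, realify_conjTranspose_eq_transpose, ← realify_conjTranspose,
    Matrix.mul_assoc, ← Matrix.mul_assoc (realify _), ← realify_mul, hρ, realify_one, Matrix.one_mul,
    kAt_mul_self]

omit [NeZero L] in
/-- **The C⋆ link field in `U(2N)`**: `W(x, μ) = 𝒥(ρ(U(x, μ))) · K(x, μ)`, the real form of the
colour link times the boundary flip of the doublet, re-indexed along `Fin 2 × Fin N ≃ Fin (2N)`, as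
a gauge field on the fundamental domain with values in the unitary group — the links of the
Wilson–Dirac operator that `D_𝒥` is (`cstarWilsonDirac_eq_reindex_wilsonDirac`).
[cite: LuciniEtAl2016, App. D (real form 𝒥(V); K boundary conditions)] -/
def cstarUnitaryLinks (hρ : ∀ g, (ρ g)ᴴ * ρ g = 1) (U : GaugeConfig 4 L G) :
    GaugeConfig 4 L (Matrix.unitaryGroup (Fin (2 * N)) ℂ) := fun e =>
  ⟨Matrix.reindex finProdFinEquiv finProdFinEquiv (realify (ρ (U e)) * kAt (N := N) S e.1 e.2), by
    rw [Matrix.mem_unitaryGroup_iff', star_eq_conjTranspose, conjTranspose_reindex, reindex_apply,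
      reindex_apply, submatrix_mul_equiv, conjTranspose_realify_mul_kAt_mul_self S ρ hρ U e.1 e.2,
      submatrix_one_equiv]⟩

omit [NeZero L] in
/-- The index bookkeeping `(x, c, s) ↦ (x, f⁻¹ c, s)`, `f : Fin 2 × Fin N ≃ Fin (2N)`, between the
tree's Wilson–Dirac index (colour `Fin (2N)`) and the doublet index of `D_𝒥`.
[cite: LuciniEtAl2016, App. D (the two-component field η)] -/
def cstarIdxProd : Site 4 L × Fin (2 * N) × Fin 4 ≃ Site 4 L × (Fin 2 × Fin N) × Fin 4 :=
  Equiv.prodCongr (Equiv.refl _) (Equiv.prodCongr finProdFinEquiv.symm (Equiv.refl _))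

omit [NeZero L] in
/-- Components of the inverse index map. [folklore] -/
private theorem cstarIdxProd_symm_apply (p : Site 4 L × (Fin 2 × Fin N) × Fin 4) :
    (cstarIdxProd (L := L) (N := N)).symm p = (p.1, finProdFinEquiv p.2.1, p.2.2) := rfl

omit [NeZero L] in
/-- Entries of the unitary links: `W(x,μ)_{f a, f b} = (𝒥(ρ U) K)_{a b}`. [folklore] -/
private theorem cstarUnitaryLinks_apply (hρ : ∀ g, (ρ g)ᴴ * ρ g = 1) (U : GaugeConfig 4 L G)
    (x : Site 4 L) (μ : Fin 4) (a b : Fin 2 × Fin N) :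
    ((cstarUnitaryLinks S ρ hρ U (x, μ) : Matrix.unitaryGroup (Fin (2 * N)) ℂ) :
        Matrix (Fin (2 * N)) (Fin (2 * N)) ℂ) (finProdFinEquiv a) (finProdFinEquiv b) =
      (realify (ρ (U (x, μ))) * kAt (N := N) S x μ) a b := by
  simp [cstarUnitaryLinks, reindex_apply]

omit [NeZero L] in
/-- Entries of the inverse links: `(W(x,μ)⁻¹)_{f a, f b} = (W(x,μ)ᴴ)_{f a, f b} = (K 𝒥(ρ U⁻¹))_{a b}`.
[folklore] -/
private theorem cstarUnitaryLinks_inv_apply (hρ : ∀ g, (ρ g)ᴴ * ρ g = 1) (U : GaugeConfig 4 L G)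
    (x : Site 4 L) (μ : Fin 4) (a b : Fin 2 × Fin N) :
    (((cstarUnitaryLinks S ρ hρ U (x, μ))⁻¹ : Matrix.unitaryGroup (Fin (2 * N)) ℂ) :
        Matrix (Fin (2 * N)) (Fin (2 * N)) ℂ) (finProdFinEquiv a) (finProdFinEquiv b) =
      (kAt (N := N) S x μ * realify (ρ (U (x, μ))⁻¹)) a b := by
  rw [← Unitary.star_eq_inv, Unitary.coe_star, star_eq_conjTranspose, conjTranspose_apply,
    cstarUnitaryLinks_apply, star_realify_mul_kAt_apply S ρ hρ]

omit [NeZero L] in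
/-- **`D_𝒥` is a Wilson–Dirac operator with unitary links**: the C⋆-periodic doublet operator equals,
up to the index bookkeeping `cstarIdxProd`, the tree's gauge-covariant Wilson–Dirac operator
`wilsonDirac` for the identity representation of `U(2N)` on the unitary link field
`cstarUnitaryLinks` (`W = 𝒥(ρ U) K`, backward hops `W⁻¹ = Wᴴ = K 𝒥(ρ U⁻¹)`), same `m`, `r`.
[cite: LuciniEtAl2016, App. D (D_𝒥 = D[𝒥(V)] with K boundary conditions; 𝒥(V) unitarily equivalent representation)] -/
theorem cstarWilsonDirac_eq_reindex_wilsonDirac (hρ : ∀ g, (ρ g)ᴴ * ρ g = 1) :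
    cstarWilsonDirac S ρ U m r =
      Matrix.reindex cstarIdxProd cstarIdxProd
        (wilsonDirac (Matrix.unitaryGroup (Fin (2 * N)) ℂ).subtype (cstarUnitaryLinks S ρ hρ U) m r) := by
  ext p q
  have hpq : ((cstarIdxProd (L := L) (N := N)).symm p = (cstarIdxProd (L := L) (N := N)).symm q) ↔
      p = q := (cstarIdxProd (L := L) (N := N)).symm.apply_eq_iff_eq
  simp only [cstarWilsonDirac, wilsonDirac, reindex_apply, submatrix_apply, Matrix.of_apply,
    cstarIdxProd_symm_apply, Submonoid.coe_subtype, cstarUnitaryLinks_apply,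
    cstarUnitaryLinks_inv_apply] at hpq ⊢
  rw [if_congr hpq rfl rfl]

/-! ## Heavy quarks (`κ < 1/8`): the C⋆ Pfaffian has a constant sign -/

omit [NeZero L] in
/-- Quadratic forms are unchanged by re-indexing: `⟨v, (reindex e e M) v⟩ = ⟨v ∘ e, M (v ∘ e)⟩`.
[folklore] -/
private theorem star_dotProduct_reindex_mulVec {ι κ : Type*} [Fintype ι] [Fintype κ] (e : ι ≃ κ)
    (M : Matrix ι ι ℂ) (v : κ → ℂ) :
    star v ⬝ᵥ Matrix.reindex e e M *ᵥ v = star (v ∘ e) ⬝ᵥ M *ᵥ (v ∘ e) := by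
  rw [reindex_apply, submatrix_mulVec_equiv, dotProduct, dotProduct]
  refine Fintype.sum_equiv e.symm _ _ fun k => ?_
  simp only [Function.comp_apply, Pi.star_apply, Equiv.symm_symm, Equiv.apply_symm_apply]

omit [NeZero L] in
/-- `⟨v ∘ e, v ∘ e⟩ = ⟨v, v⟩`. [folklore] -/
private theorem star_dotProduct_self_comp_equiv {ι κ : Type*} [Fintype ι] [Fintype κ] (e : ι ≃ κ)
    (v : κ → ℂ) : star (v ∘ e) ⬝ᵥ (v ∘ e) = star v ⬝ᵥ v := by
  rw [dotProduct, dotProduct]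
  exact Fintype.sum_equiv e _ _ fun k => rfl

omit [NeZero L] in
/-- `⟨v, v⟩ = Σ |vᵢ|²` as a real number cast to `ℂ`. [folklore] -/
private theorem star_dotProduct_self_eq_ofReal {ι : Type*} [Fintype ι] (v : ι → ℂ) :
    star v ⬝ᵥ v = ((∑ i, Complex.normSq (v i) : ℝ) : ℂ) := by
  rw [dotProduct, Complex.ofReal_sum]
  exact Finset.sum_congr rfl fun i _ => by
    rw [Pi.star_apply, Complex.star_def, ← Complex.normSq_eq_conj_mul_self]

omit [NeZero L] in
/-- `Re ⟨v, v⟩ > 0` for `v ≠ 0`. [folklore] -/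
private theorem re_star_dotProduct_self_pos {ι : Type*} [Fintype ι] {v : ι → ℂ} (hv : v ≠ 0) :
    0 < (star v ⬝ᵥ v).re := by
  rw [star_dotProduct_self_eq_ofReal, Complex.ofReal_re]
  obtain ⟨i, hi⟩ : ∃ i, v i ≠ 0 := Function.ne_iff.mp hv
  exact lt_of_lt_of_le (Complex.normSq_pos.mpr hi)
    (Finset.single_le_sum (fun j _ => Complex.normSq_nonneg (v j)) (Finset.mem_univ i))

/-- **Heavy-quark positivity of `D_𝒥`** (Montvay–Münster §7.4 "for `|K_q| < 1/8` the matrix `Q`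
can be proven to be positive", transferred to the C⋆ doublet operator through
`cstarWilsonDirac_eq_reindex_wilsonDirac` and the tree's `re_star_dotProduct_wilsonDirac_mulVec_ge`):
for `r = 1`, unitary `ρ`, EVERY gauge field and every real `m`, `Re ⟨v, D_𝒥 v⟩ ≥ m ⟨v, v⟩`.
[cite: MontvayMunster1994, §7.4 (text after (7.136))] -/
theorem re_star_dotProduct_cstarWilsonDirac_mulVec_ge (hρ : ∀ g, (ρ g)ᴴ * ρ g = 1) (m : ℝ)
    (v : Site 4 L × (Fin 2 × Fin N) × Fin 4 → ℂ) :
    m * (star v ⬝ᵥ v).re ≤ (star v ⬝ᵥ cstarWilsonDirac S ρ U m 1 *ᵥ v).re := by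
  rw [cstarWilsonDirac_eq_reindex_wilsonDirac S ρ U m 1 hρ, star_dotProduct_reindex_mulVec,
    ← star_dotProduct_self_comp_equiv cstarIdxProd v]
  exact re_star_dotProduct_wilsonDirac_mulVec_ge (Matrix.unitaryGroup (Fin (2 * N)) ℂ).subtype
    (fun g => g.2) (cstarUnitaryLinks S ρ hρ U) m (v ∘ cstarIdxProd)

/-- **Every eigenvalue of `D_𝒥` has real part `≥ m`** (`r = 1`, unitary `ρ`): an eigenvector `v`
gives `Re λ ⟨v, v⟩ = Re ⟨v, D_𝒥 v⟩ ≥ m ⟨v, v⟩`.  For `m > 0` (`κ < 1/8`) this is the lattice form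
of "the real part of the eigenvalues of the Dirac operator is always positive (and equal to `m`)".
[cite: LuciniEtAl2016, App. D (real part of the eigenvalues positive); MontvayMunster1994, §7.4 (text after (7.136))] -/
theorem re_eigenvalue_cstarWilsonDirac_ge (hρ : ∀ g, (ρ g)ᴴ * ρ g = 1) (m : ℝ) {μ : ℂ}
    (hμ : μ ∈ (cstarWilsonDirac S ρ U m 1).charpoly.roots) : m ≤ μ.re := by
  have hroot := (Polynomial.mem_roots (Matrix.charpoly_monic _).ne_zero).mp hμ
  rw [Polynomial.IsRoot.def, Matrix.eval_charpoly] at hroot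
  obtain ⟨v, hv0, hv⟩ := Matrix.exists_mulVec_eq_zero_iff.mpr hroot
  have hDv : cstarWilsonDirac S ρ U m 1 *ᵥ v = μ • v := by
    rw [sub_mulVec, sub_eq_zero, scalar_apply, ← smul_one_eq_diagonal, smul_mulVec,
      one_mulVec] at hv
    exact hv.symm
  have hpos := re_star_dotProduct_self_pos hv0
  have h := re_star_dotProduct_cstarWilsonDirac_mulVec_ge S ρ U hρ m v
  rw [hDv, dotProduct_smul, smul_eq_mul, Complex.mul_re, star_dotProduct_self_eq_ofReal,
    Complex.ofReal_im, mul_zero, sub_zero, Complex.ofReal_re] at h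
  rw [star_dotProduct_self_eq_ofReal, Complex.ofReal_re] at hpos
  exact le_of_mul_le_mul_right h hpos

/-- **No sign problem for heavy C⋆ Wilson quarks.**  For `r = 1` and bare mass `m > 0` (hopping
parameter `κ = 1/(2m + 8) < 1/8`, Montvay–Münster's positivity domain) the C⋆-periodic one-flavour
fermion Pfaffian has the SAME sign `ε = Pf(C ⊗ 1) = ±1` for EVERY gauge field `U` and every unitary
`ρ`: `Pf_K(C D_𝒥) = ε · t` with `t > 0` — all eigenvalues of `D_𝒥` have real part `≥ m > 0`
(`re_eigenvalue_cstarWilsonDirac_ge`), so the sign anatomy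
`cstarFermionPfaffian_sign_of_positive_eigenvalues` applies.  (A corollary combining the two
printed statements; the paper states the continuum-limit version "therefore the Pfaffian is
positive" and that at finite spacing the sign problem is "mild … completely analogous to the
single-flavour case".) [cite: LuciniEtAl2016, App. D (Pfaffian negative only if negative eigenvalues; continuum remark); MontvayMunster1994, §7.4 (text after (7.136))] -/
theorem cstarFermionPfaffian_sign_of_mass_pos (hρ : ∀ g, (ρ g)ᴴ * ρ g = 1) {m : ℝ} (hm : 0 < m) :
    ∃ t : ℝ, 0 < t ∧ cstarFermionPfaffian S ρ U m 1 =
      pfaffian (reindex cstarIdxEquiv cstarIdxEquiv (spinChargeConj (L := L) (N := N))) * t :=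
  cstarFermionPfaffian_sign_of_positive_eigenvalues S ρ U m 1 hρ fun _ hμ _ =>
    lt_of_lt_of_le hm (re_eigenvalue_cstarWilsonDirac_ge S ρ U hρ m hμ)

/-- Hence `Det_K D_𝒥 = (Pf_K C D_𝒥)² = t² > 0` for `m > 0`, `r = 1`: the C⋆ one-flavour Wilson
determinant is strictly positive in the heavy-quark domain (Seiler's `κ < 1/8` domain, as for the
periodic operator `fermionDet_wilsonDirac_re_pos`). [cite: MontvayMunster1994, §7.4 (text after (7.136)); LuciniEtAl2016, App. D ((Pf_K CD_𝒥)² = Det_K D_𝒥)] -/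
theorem det_cstarWilsonDirac_pos_of_mass_pos (hρ : ∀ g, (ρ g)ᴴ * ρ g = 1) {m : ℝ} (hm : 0 < m) :
    ∃ t : ℝ, 0 < t ∧ (cstarWilsonDirac S ρ U m 1).det = (t : ℂ) := by
  obtain ⟨t, ht, hPf⟩ := cstarFermionPfaffian_sign_of_mass_pos S ρ U hρ hm
  refine ⟨t ^ 2, pow_pos ht 2, ?_⟩
  rw [← cstarFermionPfaffian_sq_eq_det_of_unitary S ρ hρ U m 1, hPf, mul_pow]
  rcases pfaffian_spinChargeConj_eq_one_or (L := L) (N := N) with h | h <;> rw [h] <;> push_cast <;> ring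

end UnitaryLinks

end Literature.MathematicalPhysics.QuantumLattice

end
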